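import Summits.Ventures.CertifiedManyBodySolver.Observables.StructureFactors

/-!
# Star sums of structure factors (M3-L1 follow-up, sr-mbsolver m3-1 NOTE 1)

HONEST FRAMING: objects and exact identities only; no bound on any Hubbard state is claimed in
this file (first certified bounds are the programme; this is not a superconductivity verdict).

For a finite set `K` of torus momenta (in practice a point-group STAR of one `q`), the sum of the
spin / charge structure factors over `K` is the real-space correlator sum weighted by the summed
cosines `∑_{k ∈ K} cos (2π k·r / L)` — by name, so that a reviewer of tabulated star-averaged weights
(`testvectors/sfweights`) can cite one lemma instead of re-deriving the exchange of sums.  The generic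
bookkeeping step `sum_eq_sum_summedCoeff_mul` is stated over arbitrary index types so the
`Sᶻ`-channel and any later channel obtain the same corollary by one application.
-/

namespace Summit.Ventures.CertifiedManyBodySolver.Observables

open Literature.MathematicalPhysics.QuantumLattice Literature.Probability.LatticeModels
open scoped BigOperators

/-- Generic exchange of sums: if `S k = ∑ r, c k r * C r` for every `k`, then a finite sum of the
`S k` is the `C`-sum weighted by the summed coefficients. -/
theorem sum_eq_sum_summedCoeff_mul {ι κ : Type*} [Fintype κ] (K : Finset ι)
    (S : ι → ℝ) (c : ι → κ → ℝ) (C : κ → ℝ) (h : ∀ k, S k = ∑ r, c k r * C r) :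
    ∑ k ∈ K, S k = ∑ r, (∑ k ∈ K, c k r) * C r := by
  simp_rw [h, Finset.sum_mul]
  exact Finset.sum_comm

variable (L : ℕ) [NeZero L]

/-- Star sum of the spin structure factor: `∑_{k∈K} S_s(k;ψ) = ∑_r (∑_{k∈K} cos(2π k·r/L)) · C_s(r;ψ)`. -/
theorem sum_spinStructureFactor_eq_sum_cos_mul_spinCorr (K : Finset (TorusSite 2 L))
    (ψ : Fock (Orb (FermionTorus 2 L))) :
    ∑ k ∈ K, spinStructureFactor L k ψ =
      ∑ r : TorusSite 2 L, (∑ k ∈ K, Real.cos (2 * Real.pi * ((torusDot L k r).val : ℝ) / L))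
        * spinCorr L r ψ :=
  sum_eq_sum_summedCoeff_mul K _ (fun k r => Real.cos (2 * Real.pi * ((torusDot L k r).val : ℝ) / L)) _
    (fun k => spinStructureFactor_eq_sum_cos_mul_spinCorr L k ψ)

/-- Star sum of the charge structure factor: `∑_{k∈K} S_c(k;ψ) = ∑_r (∑_{k∈K} cos(2π k·r/L)) · C_c(r;ψ)`. -/
theorem sum_densityStructureFactor_eq_sum_cos_mul_densityCorr (K : Finset (TorusSite 2 L))
    (ψ : Fock (Orb (FermionTorus 2 L))) :
    ∑ k ∈ K, densityStructureFactor L k ψ =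
      ∑ r : TorusSite 2 L, (∑ k ∈ K, Real.cos (2 * Real.pi * ((torusDot L k r).val : ℝ) / L))
        * densityCorr L r ψ :=
  sum_eq_sum_summedCoeff_mul K _ (fun k r => Real.cos (2 * Real.pi * ((torusDot L k r).val : ℝ) / L)) _
    (fun k => densityStructureFactor_eq_sum_cos_mul_densityCorr L k ψ)

/-- Averaged form over a nonempty momentum set (the `sfweights` normalisation: weights
`|K|⁻¹ ∑_{k∈K} cos(2π k·r/L)`). -/
theorem avg_spinStructureFactor_eq_sum_avgcos_mul_spinCorr (K : Finset (TorusSite 2 L))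
    (ψ : Fock (Orb (FermionTorus 2 L))) :
    (∑ k ∈ K, spinStructureFactor L k ψ) / K.card =
      ∑ r : TorusSite 2 L, ((∑ k ∈ K, Real.cos (2 * Real.pi * ((torusDot L k r).val : ℝ) / L)) / K.card)
        * spinCorr L r ψ := by
  rw [sum_spinStructureFactor_eq_sum_cos_mul_spinCorr, Finset.sum_div]
  refine Finset.sum_congr rfl fun r _ => ?_
  rw [div_mul_eq_mul_div]

/-- Averaged form, charge channel. -/
theorem avg_densityStructureFactor_eq_sum_avgcos_mul_densityCorr (K : Finset (TorusSite 2 L))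
    (ψ : Fock (Orb (FermionTorus 2 L))) :
    (∑ k ∈ K, densityStructureFactor L k ψ) / K.card =
      ∑ r : TorusSite 2 L, ((∑ k ∈ K, Real.cos (2 * Real.pi * ((torusDot L k r).val : ℝ) / L)) / K.card)
        * densityCorr L r ψ := by
  rw [sum_densityStructureFactor_eq_sum_cos_mul_densityCorr, Finset.sum_div]
  refine Finset.sum_congr rfl fun r _ => ?_
  rw [div_mul_eq_mul_div]

end Summit.Ventures.CertifiedManyBodySolver.Observables
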